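import Mathlib
import Literature.NumberTheory.EllipticCurves.ComplexMultiplicationDeuringFrobeniusProofs
import Literature.NumberTheory.EllipticCurves.EisensteinNewformLevelRaisingInertiaProofs
import Summits.Langlands.Langlands.Theorems.ParityBlindBianchiResidualBianchiDoorMod2TwoAdicModel
import HarnessLib

/-!
# Stub `stub_scalarOnProjectiveKernel` (S4a) of the line `SketchIdeator2` for the crux
# `ParityBlindBianchi.ArtinWeightRealisationEven` (item stmt-Langlands-16619)

Pure algebra.  Let `Γ` be a group, `A` a field of characteristic `0`, `σ r : Γ → GL₂(A)` with
`σ(Γ)` finite and of projective image `A₅`, and `det r = det σ`, `tr r = ± tr σ` pointwise.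
Then `r(g)` is scalar whenever `σ(g) = c'·1` is.  Proof: `det r(g) = c'²`, `tr r(g) = 2c` with
`c = ± c'`, so by Cayley–Hamilton `r(g) = c(1 + n)` with `n² = 0`.  If `n ≠ 0`: the traces of
`r(h gᵏ)`, `k = 0, 1, 2`, give `tr r(h) + k·tr(r(h) n) ∈ {± tr σ(h)}`, three values of an affine
function in a two-element set, whence `tr(r(h) n) = 0` for every `h`; conjugating `n` to `E₁₂`
this says every `r(h)` is upper triangular, so every commutator `q` has `tr r(q) = 2`, hence
`tr σ(q) = ±2`, `det σ(q) = 1`, and `σ(q)`, of finite order and unipotent up to sign, is `±1`;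
so the projective image of `σ` is commutative, contradicting `A₅` non-commutative.

Reused tree facts: Cayley–Hamilton for `2 × 2` matrices
(`DeuringLadic.Matrix.sq_eq_trace_smul_sub_det_fin_two`), the square-zero binomial formula
(`Hida2000Thm326.one_add_pow_of_mul_self_eq_zero`) and non-commutativity of `A₅`
(`ResidualBianchiDoorMod2.exists_mul_ne_alternatingGroup_fin_five`).
-/

-- the line's namespace `Summit.Langlands.Langlands.…` (summit = problem = `Langlands`) repeats a
-- component by design
set_option linter.dupNamespace false

namespace Summit.Langlands.Langlands.Theorems.ArtinWeightRealisationEven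

open scoped MatrixGroups Matrix
open Literature.NumberTheory.EllipticCurves.DeuringLadic (Matrix.sq_eq_trace_smul_sub_det_fin_two)
open Literature.NumberTheory.EllipticCurves.Hida2000Thm326 (one_add_pow_of_mul_self_eq_zero)

universe u v

namespace ScalarOnProjectiveKernel

/-- A `2 × 2` matrix of finite order over a field of characteristic `0` with `det = 1` and
`tr = 2ε`, `ε = ±1` (i.e. characteristic polynomial `(X - ε)²`) is the scalar `ε`. -/
theorem eq_smul_one_of_pow_eq_one {A : Type*} [Field A] [CharZero A]
    {T : Matrix (Fin 2) (Fin 2) A} {ε : A} (hε : ε * ε = 1) (hdet : T.det = 1)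
    (htr : T.trace = 2 * ε) {m : ℕ} (hm : 0 < m) (hT : T ^ m = 1) :
    T = ε • (1 : Matrix (Fin 2) (Fin 2) A) := by
  have hTT : T * T = (2 * ε) • T - 1 := by
    rw [Matrix.sq_eq_trace_smul_sub_det_fin_two, htr, hdet, one_smul]
  set N : Matrix (Fin 2) (Fin 2) A := ε • T - 1 with hN
  have hN2 : N * N = 0 := by
    have h1 : N * N = (ε * ε) • (T * T) - ε • T - ε • T + 1 := by
      simp only [hN, sub_mul, mul_sub, Matrix.smul_mul, Matrix.mul_smul, smul_smul, mul_one,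
        one_mul]
      abel
    rw [h1, hTT, hε]
    module
  have hεT : ε • T = 1 + N := by rw [hN]; abel
  have hpow : (ε • T) ^ (2 * m) = 1 := by
    rw [smul_pow, pow_mul, pow_mul', hT, one_pow, pow_two, hε, one_pow, one_smul]
  rw [hεT, one_add_pow_of_mul_self_eq_zero hN2, add_eq_left] at hpow
  have hN0 : N = 0 := by
    rw [← Nat.cast_smul_eq_nsmul A] at hpow
    refine (smul_eq_zero.mp hpow).resolve_left ?_
    exact_mod_cast (Nat.mul_ne_zero two_ne_zero hm.ne')
  rw [hN0, add_zero] at hεT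
  calc T = (ε * ε) • T := by rw [hε, one_smul]
    _ = ε • (1 : Matrix (Fin 2) (Fin 2) A) := by rw [← smul_smul, hεT]

/-- Normal form of a non-zero square-zero `2 × 2` matrix over a field: it is conjugate to
`E₁₂ = !![0, 1; 0, 0]`. -/
theorem exists_mul_eq_mul_E {A : Type*} [Field A] {n : Matrix (Fin 2) (Fin 2) A}
    (h2 : n * n = 0) (h0 : n ≠ 0) :
    ∃ P : GL (Fin 2) A, n * (P : Matrix (Fin 2) (Fin 2) A) =
      (P : Matrix (Fin 2) (Fin 2) A) * !![(0 : A), 1; 0, 0] := by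
  have e00 : n 0 0 * n 0 0 + n 0 1 * n 1 0 = 0 := by
    simpa [Matrix.mul_apply, Fin.sum_univ_two] using congr_fun (congr_fun h2 0) 0
  have e10 : n 1 0 * n 0 0 + n 1 1 * n 1 0 = 0 := by
    simpa [Matrix.mul_apply, Fin.sum_univ_two] using congr_fun (congr_fun h2 1) 0
  have e11 : n 1 0 * n 0 1 + n 1 1 * n 1 1 = 0 := by
    simpa [Matrix.mul_apply, Fin.sum_univ_two] using congr_fun (congr_fun h2 1) 1
  by_cases hc : n 1 0 = 0
  · have ha : n 0 0 = 0 := by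
      rw [hc, mul_zero, add_zero] at e00
      exact mul_self_eq_zero.mp e00
    have hd : n 1 1 = 0 := by
      rw [hc, zero_mul, zero_add] at e11
      exact mul_self_eq_zero.mp e11
    have hb : n 0 1 ≠ 0 := by
      intro hb
      apply h0
      ext i j
      fin_cases i <;> fin_cases j <;> simp [ha, hb, hc, hd]
    refine ⟨Matrix.GeneralLinearGroup.mkOfDetNeZero !![n 0 1, 0; 0, 1]
      (by simp [Matrix.det_fin_two_of, hb]), ?_⟩
    ext i j
    fin_cases i <;> fin_cases j <;> simp [Matrix.mul_apply, Fin.sum_univ_two, ha, hc, hd]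
  · refine ⟨Matrix.GeneralLinearGroup.mkOfDetNeZero !![n 0 0, 1; n 1 0, 0]
      (by simp [Matrix.det_fin_two_of, hc]), ?_⟩
    ext i j
    fin_cases i <;> fin_cases j <;> simp [Matrix.mul_apply, Fin.sum_univ_two]
    · linear_combination e00
    · linear_combination e10

/-- Sign bookkeeping: from `c·x = ± c'·y` with `c = ± c'`, `c' ≠ 0`, get `x = ± y`. -/
theorem eq_or_eq_neg_of_mul_eq {A : Type*} [Field A] {c c' x y : A} (hc' : c' ≠ 0)
    (hcc : c = c' ∨ c = -c') (h : c * x = c' * y ∨ c * x = -(c' * y)) : x = y ∨ x = -y := by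
  rcases hcc with rfl | rfl <;> rcases h with h | h
  · exact Or.inl (mul_left_cancel₀ hc' h)
  · exact Or.inr (mul_left_cancel₀ hc' (by linear_combination h))
  · exact Or.inr (mul_left_cancel₀ hc' (by linear_combination -h))
  · exact Or.inl (mul_left_cancel₀ hc' (by linear_combination -h))

/-- Three consecutive values `α, α + β, α + 2β` of an arithmetic progression in a field of
characteristic `0` lying in the two-element set `{t, -t}` force `β = 0`. -/
theorem eq_zero_of_three_mem_pair {A : Type*} [Field A] [CharZero A] {α β t : A}
    (ha : α = t ∨ α = -t) (hb : α + β = t ∨ α + β = -t)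
    (hc : α + 2 * β = t ∨ α + 2 * β = -t) : β = 0 := by
  have hβ : β = 0 ∨ (2 : A) * β = 0 := by
    rcases ha with ha | ha <;> rcases hb with hb | hb <;> rcases hc with hc | hc <;>
      first
      | exact Or.inl (by linear_combination hb - ha)
      | exact Or.inr (by linear_combination hc - ha)
      | exact Or.inl (by linear_combination hc - hb)
  exact hβ.elim id fun h => (mul_eq_zero.mp h).resolve_left two_ne_zero

/-- The core contradiction: with `σ`, `r` as in the stub, there is no `g` with `σ(g) = c'·1`
scalar and `r(g) = c(1 + n)`, `c = ± c'`, `n` a **non-zero** square-zero matrix. -/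
theorem false_of_shear {Γ : Type u} [Group Γ] {A : Type v} [Field A] [CharZero A]
    (σ r : Γ →* GL (Fin 2) A) (hfin : Finite σ.range)
    (hA5 : Nonempty ((Matrix.ProjGenLinGroup.mk.comp σ).range ≃* alternatingGroup (Fin 5)))
    (hdt : ∀ g : Γ, Matrix.det ((r g : GL (Fin 2) A) : Matrix (Fin 2) (Fin 2) A) =
        Matrix.det ((σ g : GL (Fin 2) A) : Matrix (Fin 2) (Fin 2) A) ∧
      (Matrix.trace ((r g : GL (Fin 2) A) : Matrix (Fin 2) (Fin 2) A) =
          Matrix.trace ((σ g : GL (Fin 2) A) : Matrix (Fin 2) (Fin 2) A) ∨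
       Matrix.trace ((r g : GL (Fin 2) A) : Matrix (Fin 2) (Fin 2) A) =
          -Matrix.trace ((σ g : GL (Fin 2) A) : Matrix (Fin 2) (Fin 2) A)))
    {g : Γ} {c' c : A} {n : Matrix (Fin 2) (Fin 2) A} (hc' : c' ≠ 0) (hcc : c = c' ∨ c = -c')
    (hσg : ((σ g : GL (Fin 2) A) : Matrix (Fin 2) (Fin 2) A) =
      c' • (1 : Matrix (Fin 2) (Fin 2) A))
    (hrg : ((r g : GL (Fin 2) A) : Matrix (Fin 2) (Fin 2) A) = c • (1 + n))
    (hn2 : n * n = 0) (hn0 : n ≠ 0) : False := by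
  haveI := hfin
  -- Step A: `tr (r(h) n) = 0` for every `h`.
  have htr0 : ∀ h : Γ,
      Matrix.trace (((r h : GL (Fin 2) A) : Matrix (Fin 2) (Fin 2) A) * n) = 0 := by
    intro h
    have ha := (hdt h).2
    have hb : Matrix.trace ((r h : GL (Fin 2) A) : Matrix (Fin 2) (Fin 2) A) +
          Matrix.trace (((r h : GL (Fin 2) A) : Matrix (Fin 2) (Fin 2) A) * n) =
          Matrix.trace ((σ h : GL (Fin 2) A) : Matrix (Fin 2) (Fin 2) A) ∨
        Matrix.trace ((r h : GL (Fin 2) A) : Matrix (Fin 2) (Fin 2) A) +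
          Matrix.trace (((r h : GL (Fin 2) A) : Matrix (Fin 2) (Fin 2) A) * n) =
          -Matrix.trace ((σ h : GL (Fin 2) A) : Matrix (Fin 2) (Fin 2) A) := by
      have h1 := (hdt (h * g)).2
      have e1 : Matrix.trace ((r (h * g) : GL (Fin 2) A) : Matrix (Fin 2) (Fin 2) A) =
          c * (Matrix.trace ((r h : GL (Fin 2) A) : Matrix (Fin 2) (Fin 2) A) +
            Matrix.trace (((r h : GL (Fin 2) A) : Matrix (Fin 2) (Fin 2) A) * n)) := by
        rw [map_mul, Units.val_mul, hrg, Matrix.mul_smul, Matrix.trace_smul, mul_add, mul_one,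
          Matrix.trace_add, smul_eq_mul]
      have e2 : Matrix.trace ((σ (h * g) : GL (Fin 2) A) : Matrix (Fin 2) (Fin 2) A) =
          c' * Matrix.trace ((σ h : GL (Fin 2) A) : Matrix (Fin 2) (Fin 2) A) := by
        rw [map_mul, Units.val_mul, hσg, Matrix.mul_smul, mul_one, Matrix.trace_smul, smul_eq_mul]
      rw [e1, e2] at h1
      exact eq_or_eq_neg_of_mul_eq hc' hcc h1
    have hc : Matrix.trace ((r h : GL (Fin 2) A) : Matrix (Fin 2) (Fin 2) A) +
          2 * Matrix.trace (((r h : GL (Fin 2) A) : Matrix (Fin 2) (Fin 2) A) * n) =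
          Matrix.trace ((σ h : GL (Fin 2) A) : Matrix (Fin 2) (Fin 2) A) ∨
        Matrix.trace ((r h : GL (Fin 2) A) : Matrix (Fin 2) (Fin 2) A) +
          2 * Matrix.trace (((r h : GL (Fin 2) A) : Matrix (Fin 2) (Fin 2) A) * n) =
          -Matrix.trace ((σ h : GL (Fin 2) A) : Matrix (Fin 2) (Fin 2) A) := by
      have h1 := (hdt (h * g * g)).2
      have e1 : Matrix.trace ((r (h * g * g) : GL (Fin 2) A) : Matrix (Fin 2) (Fin 2) A) =
          c ^ 2 * (Matrix.trace ((r h : GL (Fin 2) A) : Matrix (Fin 2) (Fin 2) A) +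
            2 * Matrix.trace (((r h : GL (Fin 2) A) : Matrix (Fin 2) (Fin 2) A) * n)) := by
        rw [map_mul, map_mul, Units.val_mul, Units.val_mul, hrg]
        simp only [Matrix.mul_smul, Matrix.smul_mul, mul_add, mul_one, add_mul, Matrix.mul_assoc,
          hn2, mul_zero, add_zero, Matrix.trace_smul, Matrix.trace_add, smul_eq_mul]
        ring
      have e2 : Matrix.trace ((σ (h * g * g) : GL (Fin 2) A) : Matrix (Fin 2) (Fin 2) A) =
          c' ^ 2 * Matrix.trace ((σ h : GL (Fin 2) A) : Matrix (Fin 2) (Fin 2) A) := by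
        rw [map_mul, map_mul, Units.val_mul, Units.val_mul, hσg]
        simp only [Matrix.mul_smul, mul_one, Matrix.trace_smul, smul_eq_mul]
        ring
      rw [e1, e2] at h1
      have hcc2 : c ^ 2 = c' ^ 2 ∨ c ^ 2 = -c' ^ 2 := by
        rcases hcc with rfl | rfl
        · exact Or.inl rfl
        · exact Or.inl (by ring)
      exact eq_or_eq_neg_of_mul_eq (pow_ne_zero 2 hc') hcc2 h1
    exact eq_zero_of_three_mem_pair ha hb hc
  -- Step B: conjugate `n` to `E = E₁₂`.
  obtain ⟨P, hP⟩ := exists_mul_eq_mul_E hn2 hn0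
  set E : Matrix (Fin 2) (Fin 2) A := !![(0 : A), 1; 0, 0] with hE
  -- the conjugated representation, as matrices
  set Y : Γ → Matrix (Fin 2) (Fin 2) A :=
    fun h => ((P⁻¹ * r h * P : GL (Fin 2) A) : Matrix (Fin 2) (Fin 2) A) with hY
  have hYmul : ∀ h k, Y (h * k) = Y h * Y k := by
    intro h k
    simp only [hY]
    rw [← Units.val_mul, map_mul]
    congr 1
    group
  have hY1 : Y 1 = 1 := by simp [hY]
  -- Step C: every `Y h` is upper triangular.
  have hY10 : ∀ h, Y h 1 0 = 0 := by
    intro h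
    have h1 : Matrix.trace (Y h * E) = Y h 1 0 := by
      simp [hE, Matrix.trace_fin_two, Matrix.mul_apply, Fin.sum_univ_two]
    have h2 : Y h * E = ((P⁻¹ : GL (Fin 2) A) : Matrix (Fin 2) (Fin 2) A) *
        ((((r h : GL (Fin 2) A)) : Matrix (Fin 2) (Fin 2) A) * n) *
          (P : Matrix (Fin 2) (Fin 2) A) := by
      simp only [hY, Units.val_mul, Matrix.mul_assoc, ← hP]
    rw [← h1, h2, Matrix.trace_mul_cycle, Units.mul_inv, Matrix.one_mul, htr0]
  -- Step D: the diagonal entries are multiplicative.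
  have h00 : ∀ h k, Y (h * k) 0 0 = Y h 0 0 * Y k 0 0 := by
    intro h k
    rw [hYmul, Matrix.mul_apply, Fin.sum_univ_two, hY10 k, mul_zero, add_zero]
  have h11 : ∀ h k, Y (h * k) 1 1 = Y h 1 1 * Y k 1 1 := by
    intro h k
    rw [hYmul, Matrix.mul_apply, Fin.sum_univ_two, hY10 h, zero_mul, zero_add]
  -- Step E: commutators have trace `2` under `r`.
  have htrY : ∀ h k, Matrix.trace (Y (h * k * h⁻¹ * k⁻¹)) = 2 := by
    intro h k
    have a1 : Y h 0 0 * Y h⁻¹ 0 0 = 1 := by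
      rw [← h00, mul_inv_cancel, hY1, Matrix.one_apply_eq]
    have a2 : Y k 0 0 * Y k⁻¹ 0 0 = 1 := by
      rw [← h00, mul_inv_cancel, hY1, Matrix.one_apply_eq]
    have b1 : Y h 1 1 * Y h⁻¹ 1 1 = 1 := by
      rw [← h11, mul_inv_cancel, hY1, Matrix.one_apply_eq]
    have b2 : Y k 1 1 * Y k⁻¹ 1 1 = 1 := by
      rw [← h11, mul_inv_cancel, hY1, Matrix.one_apply_eq]
    rw [Matrix.trace_fin_two, h00, h00, h00, h11, h11, h11]
    linear_combination (Y k 0 0 * Y k⁻¹ 0 0) * a1 + a2 + (Y k 1 1 * Y k⁻¹ 1 1) * b1 + b2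
  have htrR : ∀ h k, Matrix.trace (((r (h * k * h⁻¹ * k⁻¹) : GL (Fin 2) A)) :
      Matrix (Fin 2) (Fin 2) A) = 2 := by
    intro h k
    rw [← htrY h k]
    simp only [hY, Units.val_mul]
    rw [Matrix.trace_mul_cycle, Units.mul_inv, Matrix.one_mul]
  -- Step F–H: commutators are killed by `σ` projectively.
  have hmk : ∀ h k, Matrix.ProjGenLinGroup.mk (σ (h * k * h⁻¹ * k⁻¹)) = 1 := by
    intro h k
    set q := h * k * h⁻¹ * k⁻¹ with hq
    have hdetq : Matrix.det ((σ q : GL (Fin 2) A) : Matrix (Fin 2) (Fin 2) A) = 1 := by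
      have h1 : Matrix.GeneralLinearGroup.det (σ q) = 1 := by
        simp only [hq, map_mul, map_inv]
        exact mul_inv_eq_one.2 (mul_inv_eq_iff_eq_mul.2 (mul_comm _ _))
      have h2 := congrArg (fun u : Aˣ => (u : A)) h1
      simpa [Matrix.GeneralLinearGroup.val_det_apply] using h2
    obtain ⟨ε, hε, htrq⟩ : ∃ ε : A, ε * ε = 1 ∧
        Matrix.trace ((σ q : GL (Fin 2) A) : Matrix (Fin 2) (Fin 2) A) = 2 * ε := by
      have h1 := (hdt q).2
      rw [hq, htrR h k, ← hq] at h1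
      rcases h1 with h1 | h1
      · exact ⟨1, one_mul 1, by rw [← h1]; ring⟩
      · exact ⟨-1, by ring, by linear_combination h1⟩
    have hfo : IsOfFinOrder (σ q) :=
      σ.range.subtype.isOfFinOrder (isOfFinOrder_of_finite (⟨σ q, q, rfl⟩ : σ.range))
    obtain ⟨m, hm, hqm⟩ := hfo.exists_pow_eq_one
    have hTm : ((σ q : GL (Fin 2) A) : Matrix (Fin 2) (Fin 2) A) ^ m = 1 := by
      rw [← Units.val_pow_eq_pow_val, hqm, Units.val_one]
    have hT := eq_smul_one_of_pow_eq_one hε hdetq htrq hm hTm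
    rw [Matrix.ProjGenLinGroup.mk_eq_one,
      Matrix.GeneralLinearGroup.mem_center_iff_val_mem_range_scalar]
    refine ⟨ε, ?_⟩
    change Matrix.scalar (Fin 2) ε = ((σ q : GL (Fin 2) A) : Matrix (Fin 2) (Fin 2) A)
    rw [hT, Matrix.scalar_apply, Matrix.smul_one_eq_diagonal]
  -- Step I: the projective image of `σ` is commutative, but `A₅` is not.
  have hcomm : ∀ h k : Γ, Matrix.ProjGenLinGroup.mk (σ h) * Matrix.ProjGenLinGroup.mk (σ k) =
      Matrix.ProjGenLinGroup.mk (σ k) * Matrix.ProjGenLinGroup.mk (σ h) := by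
    intro h k
    have h1 := hmk h k
    simp only [map_mul, map_inv] at h1
    rwa [mul_inv_eq_one, mul_inv_eq_iff_eq_mul] at h1
  obtain ⟨e⟩ := hA5
  obtain ⟨a, b, hab⟩ := ResidualBianchiDoorMod2.exists_mul_ne_alternatingGroup_fin_five
  apply hab
  obtain ⟨x, rfl⟩ := e.surjective a
  obtain ⟨y, rfl⟩ := e.surjective b
  rw [← map_mul, ← map_mul]
  congr 1
  obtain ⟨x, h, rfl⟩ := x
  obtain ⟨y, k, rfl⟩ := y
  ext
  exact congrArg (fun z : PGL(Fin 2, A) => z) (hcomm h k)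

end ScalarOnProjectiveKernel

open ScalarOnProjectiveKernel in
/-- S4a (algebra): for `σ` with finite image and projective image `A₅` and `r` with
`det r = det σ`, `tr r = ± tr σ` pointwise, `r(g)` is central (scalar) whenever `σ(g)` is. -/
theorem stub_scalarOnProjectiveKernel :
    ∀ (Γ : Type u) [Group Γ] (A : Type v) [Field A] [IsAlgClosed A] [CharZero A]
      (σ r : Γ →* GL (Fin 2) A), Finite σ.range →
      Nonempty ((Matrix.ProjGenLinGroup.mk.comp σ).range ≃* alternatingGroup (Fin 5)) →
      (∀ g : Γ, Matrix.det ((r g : GL (Fin 2) A) : Matrix (Fin 2) (Fin 2) A) =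
          Matrix.det ((σ g : GL (Fin 2) A) : Matrix (Fin 2) (Fin 2) A) ∧
        (Matrix.trace ((r g : GL (Fin 2) A) : Matrix (Fin 2) (Fin 2) A) =
            Matrix.trace ((σ g : GL (Fin 2) A) : Matrix (Fin 2) (Fin 2) A) ∨
         Matrix.trace ((r g : GL (Fin 2) A) : Matrix (Fin 2) (Fin 2) A) =
            -Matrix.trace ((σ g : GL (Fin 2) A) : Matrix (Fin 2) (Fin 2) A))) →
      ∀ g : Γ, σ g ∈ Subgroup.center (GL (Fin 2) A) → r g ∈ Subgroup.center (GL (Fin 2) A) := by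
  intro Γ _ A _ _ _ σ r hfin hA5 hdt g hg
  obtain ⟨c', hc'⟩ := Matrix.GeneralLinearGroup.mem_center_iff_val_mem_range_scalar.mp hg
  have hσg : ((σ g : GL (Fin 2) A) : Matrix (Fin 2) (Fin 2) A) =
      c' • (1 : Matrix (Fin 2) (Fin 2) A) := by
    rw [← hc', Matrix.scalar_apply, Matrix.smul_one_eq_diagonal]
  have hc'0 : c' ≠ 0 := by
    rintro rfl
    have hu := ((Matrix.isUnit_iff_isUnit_det _).mp (σ g).isUnit).ne_zero
    rw [hσg, zero_smul] at hu
    simp at hu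
  obtain ⟨hdetg, htrg⟩ := hdt g
  rw [hσg] at hdetg htrg
  simp only [Matrix.det_smul, Matrix.det_one, Fintype.card_fin, mul_one, Matrix.trace_smul,
    Matrix.trace_one, Nat.cast_ofNat, smul_eq_mul] at hdetg htrg
  obtain ⟨c, hcc, htr⟩ : ∃ c : A, (c = c' ∨ c = -c') ∧
      Matrix.trace ((r g : GL (Fin 2) A) : Matrix (Fin 2) (Fin 2) A) = 2 * c := by
    rcases htrg with h | h
    · exact ⟨c', Or.inl rfl, by rw [h]; ring⟩
    · exact ⟨-c', Or.inr rfl, by rw [h]; ring⟩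
  have hdet' : Matrix.det ((r g : GL (Fin 2) A) : Matrix (Fin 2) (Fin 2) A) = c * c := by
    rcases hcc with rfl | rfl
    · rw [hdetg]; ring
    · rw [hdetg]; ring
  set N : Matrix (Fin 2) (Fin 2) A :=
    ((r g : GL (Fin 2) A) : Matrix (Fin 2) (Fin 2) A) - c • 1 with hN
  have hN2 : N * N = 0 := by
    have h := Matrix.sq_eq_trace_smul_sub_det_fin_two
      ((r g : GL (Fin 2) A) : Matrix (Fin 2) (Fin 2) A)
    rw [htr, hdet'] at h
    have h1 : N * N = ((r g : GL (Fin 2) A) : Matrix (Fin 2) (Fin 2) A) *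
        ((r g : GL (Fin 2) A) : Matrix (Fin 2) (Fin 2) A) -
        c • ((r g : GL (Fin 2) A) : Matrix (Fin 2) (Fin 2) A) -
        c • ((r g : GL (Fin 2) A) : Matrix (Fin 2) (Fin 2) A) + (c * c) • 1 := by
      simp only [hN, sub_mul, mul_sub, Matrix.smul_mul, Matrix.mul_smul, smul_smul, mul_one,
        one_mul]
      abel
    rw [h1, h]
    module
  by_cases hN0 : N = 0
  · have hRg : ((r g : GL (Fin 2) A) : Matrix (Fin 2) (Fin 2) A) = c • 1 := sub_eq_zero.mp hN0
    refine Matrix.GeneralLinearGroup.mem_center_iff_val_mem_range_scalar.mpr ⟨c, ?_⟩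
    change Matrix.scalar (Fin 2) c = ((r g : GL (Fin 2) A) : Matrix (Fin 2) (Fin 2) A)
    rw [hRg, Matrix.scalar_apply, Matrix.smul_one_eq_diagonal]
  · exfalso
    have hc0 : c ≠ 0 := by
      rcases hcc with rfl | rfl
      · exact hc'0
      · exact neg_ne_zero.mpr hc'0
    refine false_of_shear σ r hfin hA5 hdt hc'0 hcc hσg (n := c⁻¹ • N) ?_ ?_ ?_
    · rw [smul_add, smul_smul, mul_inv_cancel₀ hc0, one_smul, hN]
      abel
    · rw [Matrix.smul_mul, Matrix.mul_smul, hN2, smul_zero, smul_zero]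
    · exact smul_ne_zero (inv_ne_zero hc0) hN0

end Summit.Langlands.Langlands.Theorems.ArtinWeightRealisationEven
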